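import Summits.ABC.ABC.Theorems.DefiniteXiDefiniteRTControlPrimeOfTakahashi
import HarnessLib

/-!
# Line `Takahashi` — ONE-stub skeleton for crux `DefiniteRTControlPrime` (stmt-ABC-11338)

CANDIDATE written by stub-ideation seat k3 (gen 18); NOT registered (`ledger skeleton check` is the
lead's / crux-plan's call).  Since part 7 of the k2-g12 chain landed
(`Summits/ABC/ABC/Theorems/DefiniteXiDefiniteRTControlPrimeOfTakahashi.lean`, 2026-09-01), the crux
follows from Takahashi 2001, Thm. 2.3 (coprime form) ALONE — no Pasten `163·δ`, no Pasten Lemma 6.8,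
no Mazur–Kenku.  The only stub is the reviewed NAMED LITERATURE FACT
`Literature.NumberTheory.EllipticCurves.takahashi2001_thm_2_3_of_coprime` (a fact leaf: provable in
tree only from a geometric Brandt dictionary, `takahashi2001_thm_2_3_of_coprime_of_brandtDictionary_one'`,
whose construction — Néron model of `J₀(Mr)` at `r ∥ Mr`, Grothendieck's monodromy pairing,
Ribet/Kohel `X_r ≅ ℤ[Cls O]⁰`, optimal-quotient functoriality — is absent from tree and Mathlib).
The composition consumes the stub through ONE one-sided call,
`takahashi2001_thm_2_3_of_coprime.modularDegree_le_brandtXi_mul`, at the Takahashi pivot `(W⋆, P⋆)`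
(`…OfTakahashiGlue.lean`, `deg_le_of_optimalIsogenyAt`). [cite: Takahashi2001, Thm. 2.3 (p. 79)]
-/

set_option linter.dupNamespace false

namespace Summit.ABC.ABC.Cruxes.DefiniteRTControlPrime.Takahashi

open Literature.NumberTheory.EllipticCurves Literature.NumberTheory.EllipticCurves.ModularForms
open Literature.NumberTheory.Automorphic

/-- stub (FACT LEAF, XL to discharge, XS to consume): Takahashi 2001, Theorem 2.3 in the coprime
form `gcd(M, r) = 1` — for an optimal `W` of conductor `Mr` and every Brandt setup `S` of type
`(M, r)`: `∃ i j, 0 < i ∧ i·j = ord_r Δ_min(W) ∧ i ∣ ξ_S ∧ deg P · i = ξ_S · j`.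
Closing path: `blocked-on` the named fact (no hypothesis-free proof in tree; see the line card /
STUB-IDEAS sheets k1–k3). [cite: Takahashi2001, Thm. 2.3 (p. 79)] -/
theorem stub_takahashi : takahashi2001_thm_2_3_of_coprime := by
  sorry

/-- **Composition** (kernel-checked, no sorry): the stub statement implies the crux BY NAME, via the
landed `definiteRTControlPrime_of_takahashi` (part 7 of the one-isogeny re-glue). -/
theorem DefiniteRTControlPrime_of :
    takahashi2001_thm_2_3_of_coprime →
      Summit.ABC.ABC.Theses.DefiniteXi.DefiniteRTControlPrime :=
  Summit.ABC.ABC.Theorems.DefiniteRTControlPrime.definiteRTControlPrime_of_takahashi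

/-- The crux from the stub (term form). -/
theorem definiteRTControlPrime : Summit.ABC.ABC.Theses.DefiniteXi.DefiniteRTControlPrime :=
  DefiniteRTControlPrime_of stub_takahashi

end Summit.ABC.ABC.Cruxes.DefiniteRTControlPrime.Takahashi
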